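import Summits.Ventures.HodgeRepro2.T5SU11RadialGreenImproper
import Summits.Ventures.HodgeRepro2.T5SU11ResolventBoundary

/-!
# The improper Green's solution of the explicit model is bounded at the origin

For the explicit model (`φ = φ_λ(a_·)`, `χ = χ_λ = φ_λ T_λ`, `λ > 1`, rows 443–448) and a source `g` continuous on
`(0, ∞)`, BOUNDED on `(0, 1]` and integrable against the basis (`φ_λ g sinh 2s` on every `(0, T]`, `χ_λ g sinh 2s` on
`(0, ∞)`), the improper Green's solution `G^I g = −χ_λ B^I − φ_λ A^I` of row 492 is bounded as `t → 0⁺`: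

* the tail integral `T_λ` grows only logarithmically at the origin: **`T_λ(t) ≤ T_λ(1) + (−log t)/(2m)`** for
  `0 < t ≤ 1`, `m = min_{[0,1]} φ_λ² > 0` (`tailIntegral_le_of_le_one`: `sinh 2s ≥ 2s`, `∫_t^1 ds/s = −log t`);
* `|B^I(t)| ≤ Φ M sinh 2 · t` (`abs_greenBI_le`), so **`χ_λ(t) B^I(t) → 0`** as `t → 0⁺`
  (`tendsto_sphDecay_mul_greenBI`: `t log t → 0`);
* `|A^I(t)| ≤ ∫_{(0,∞)} |χ_λ g sinh 2s|` (`abs_greenAI_le`), and `φ_λ ≤ Φ` on `[0, 1]`;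

hence **`∃ B, |G^I g| ≤ B` near `0`** (`eventually_abs_greenSolI_le`) — the condition row 446's uniqueness theorem
needs at the origin. Nothing is claimed about (N).

Blind lane: Mathlib + the HodgeRepro2 prefix only; no sorry; axioms ⊆ {propext, Classical.choice,
Quot.sound}.
-/

namespace Summit.Ventures.HodgeRepro2.T5SU11RadialGreenImproperOrigin

open Filter Topology MeasureTheory intervalIntegral
open Set (Ioi Ioc Icc)
open T5SU11Cartan T5SU11SphericalFunction T5SU11SphericalBounds T5SU11SphericalContinuous
  T5SU11SphericalSolutionSpaceAll T5SU11ReductionOfOrder T5SU11ReductionOfOrderInfinity T5SU11SphericalDecay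
  T5SU11RadialGreenImproper

section measure

variable [MeasurableSpace Circle] [BorelSpace Circle]

/-! ### Bounds for `φ_λ` on `[0, 1]` -/

/-- `φ_λ² ≥ m > 0` on `[0, 1]`. -/
theorem exists_sph_hyp_sq_ge (lam : ℝ) : ∃ m : ℝ, 0 < m ∧ ∀ s ∈ Icc (0 : ℝ) 1, m ≤ sph lam (hyp s) ^ 2 := by
  obtain ⟨s₀, _, hmin⟩ := isCompact_Icc.exists_isMinOn (Set.nonempty_Icc.mpr zero_le_one)
    ((continuous_sph_hyp lam).pow 2).continuousOn
  exact ⟨sph lam (hyp s₀) ^ 2, pow_pos (sph_hyp_pos lam s₀) 2, fun s hs => (isMinOn_iff.mp hmin) s hs⟩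

/-- `φ_λ ≤ Φ` on `[0, 1]`, with `Φ > 0`. -/
theorem exists_sph_hyp_le (lam : ℝ) : ∃ Φ : ℝ, 0 < Φ ∧ ∀ s ∈ Icc (0 : ℝ) 1, sph lam (hyp s) ≤ Φ := by
  obtain ⟨s₀, _, hmax⟩ := isCompact_Icc.exists_isMaxOn (Set.nonempty_Icc.mpr zero_le_one)
    (continuous_sph_hyp lam).continuousOn
  exact ⟨sph lam (hyp s₀), sph_hyp_pos lam s₀, fun s hs => (isMaxOn_iff.mp hmax) s hs⟩

/-! ### The tail integral at the origin -/

/-- **`T_λ(t) ≤ T_λ(1) + (−log t)/(2m)`** for `0 < t ≤ 1`, where `m ≤ φ_λ²` on `[0, 1]`. -/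
theorem tailIntegral_le_of_le_one {lam : ℝ} (hlam : 1 < lam) {m : ℝ} (hm : 0 < m)
    (hmin : ∀ s ∈ Icc (0 : ℝ) 1, m ≤ sph lam (hyp s) ^ 2) {t : ℝ} (ht : 0 < t) (ht1 : t ≤ 1) :
    tailIntegral (fun t => sph lam (hyp t)) t
      ≤ tailIntegral (fun t => sph lam (hyp t)) 1 + (-Real.log t) / (2 * m) := by
  have hI1 : IntegrableOn (roIntegrand (fun t => sph lam (hyp t))) (Ioc t 1) :=
    integrableOn_roIntegrand_Ioc (hφ_sph lam) (hpos_sph lam) ht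
  have hI2 : IntegrableOn (roIntegrand (fun t => sph lam (hyp t))) (Ioi 1) :=
    integrableOn_roIntegrand_Ioi (hφ_sph lam) (hpos_sph lam) (integrableOn_roIntegrand_sph hlam) one_pos
  have hsplit : Ioc t 1 ∪ Ioi 1 = Ioi t := Set.Ioc_union_Ioi_eq_Ioi ht1
  have hdisj : Disjoint (Ioc t 1) (Ioi 1) := Set.Ioc_disjoint_Ioi le_rfl
  have hT : tailIntegral (fun t => sph lam (hyp t)) t
      = (∫ s in t..1, roIntegrand (fun t => sph lam (hyp t)) s) + tailIntegral (fun t => sph lam (hyp t)) 1 := by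
    unfold tailIntegral
    rw [← hsplit, setIntegral_union hdisj measurableSet_Ioi hI1 hI2, integral_of_le ht1]
  rw [hT]
  suffices hle : ∫ s in t..1, roIntegrand (fun t => sph lam (hyp t)) s ≤ (-Real.log t) / (2 * m) by linarith
  -- the pointwise bound `r(s) ≤ 1/(2 m s)` on `[t, 1]`
  have hpt : ∀ s ∈ Icc t 1, roIntegrand (fun t => sph lam (hyp t)) s ≤ (1 / (2 * m)) * s⁻¹ := by
    intro s hs
    have hs0 : 0 < s := lt_of_lt_of_le ht hs.1
    have hsinh : 2 * s ≤ Real.sinh (2 * s) := Real.self_le_sinh_iff.mpr (by linarith)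
    have hφ : m ≤ sph lam (hyp s) ^ 2 := hmin s ⟨hs0.le, hs.2⟩
    unfold roIntegrand
    rw [show (1 / (2 * m)) * s⁻¹ = 1 / (2 * s * m) by field_simp]
    refine one_div_le_one_div_of_le (by positivity) ?_
    calc 2 * s * m ≤ Real.sinh (2 * s) * m := mul_le_mul_of_nonneg_right hsinh hm.le
      _ ≤ Real.sinh (2 * s) * sph lam (hyp s) ^ 2 :=
          mul_le_mul_of_nonneg_left hφ (sinh_two_mul_pos hs0).le
  have hint1 : IntervalIntegrable (roIntegrand (fun t => sph lam (hyp t))) volume t 1 :=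
    (intervalIntegrable_iff_integrableOn_Ioc_of_le ht1).mpr hI1
  have hint2 : IntervalIntegrable (fun s : ℝ => (1 / (2 * m)) * s⁻¹) volume t 1 := by
    refine (intervalIntegrable_inv (f := fun s : ℝ => s) (fun s hs => ?_) continuousOn_id).const_mul _
    rw [Set.uIcc_of_le ht1] at hs
    exact (lt_of_lt_of_le ht hs.1).ne'
  calc ∫ s in t..1, roIntegrand (fun t => sph lam (hyp t)) s
      ≤ ∫ s in t..1, (1 / (2 * m)) * s⁻¹ := integral_mono_on ht1 hint1 hint2 hpt
    _ = (-Real.log t) / (2 * m) := by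
        rw [intervalIntegral.integral_const_mul, integral_inv_of_pos ht one_pos, Real.log_div one_ne_zero ht.ne',
          Real.log_one]
        ring

/-! ### The improper Green's solution at the origin -/

variable {lam : ℝ} (hlam : 1 < lam) {g : ℝ → ℝ} (hg : ContinuousOn g (Ioi 0))
  {M : ℝ} (hM : ∀ s ∈ Ioc (0 : ℝ) 1, |g s| ≤ M) (hM0 : 0 ≤ M)
  (hB : ∀ T, IntegrableOn (fun s => sph lam (hyp s) * g s * Real.sinh (2 * s)) (Ioc 0 T))
  (hA : IntegrableOn (fun s => sphDecay lam s * g s * Real.sinh (2 * s)) (Ioi 0))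

include hM hM0 in
/-- **`|B^I(t)| ≤ Φ M sinh 2 · t`** for `0 < t ≤ 1`, where `φ_λ ≤ Φ` on `[0, 1]` and `|g| ≤ M` on `(0, 1]`. -/
theorem abs_greenBI_le {Φ : ℝ} (hΦ : ∀ s ∈ Icc (0 : ℝ) 1, sph lam (hyp s) ≤ Φ) (hΦ0 : 0 ≤ Φ)
    {t : ℝ} (ht : 0 < t) (ht1 : t ≤ 1) :
    |greenBI (fun t => sph lam (hyp t)) g t| ≤ Φ * M * Real.sinh 2 * t := by
  unfold greenBI
  have h := norm_setIntegral_le_of_norm_le_const (μ := volume) (s := Ioc 0 t)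
    (f := fun s => sph lam (hyp s) * g s * Real.sinh (2 * s)) (C := Φ * M * Real.sinh 2)
    (by rw [Real.volume_Ioc]; exact ENNReal.ofReal_lt_top) (fun s hs => ?_)
  · rw [Real.norm_eq_abs, Real.volume_real_Ioc_of_le ht.le, sub_zero] at h
    exact h
  · have hs0 : 0 < s := hs.1
    rw [Real.norm_eq_abs, abs_mul, abs_mul, abs_of_pos (sph_hyp_pos lam s),
      abs_of_nonneg (Real.sinh_nonneg_iff.mpr (by linarith))]
    have h1 : sph lam (hyp s) ≤ Φ := hΦ s ⟨hs0.le, le_trans hs.2 ht1⟩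
    have h2 : |g s| ≤ M := hM s ⟨hs0, le_trans hs.2 ht1⟩
    have h3 : Real.sinh (2 * s) ≤ Real.sinh 2 := Real.sinh_le_sinh.mpr (by linarith [hs.2])
    exact mul_le_mul (mul_le_mul h1 h2 (abs_nonneg _) hΦ0) h3
      (Real.sinh_nonneg_iff.mpr (by linarith)) (mul_nonneg hΦ0 hM0)

include hlam hM hM0 in
/-- **`χ_λ(t) B^I(t) → 0` as `t → 0⁺`**: `χ_λ = O(log(1/t))` against `B^I = O(t)`. -/
theorem tendsto_sphDecay_mul_greenBI :
    Tendsto (fun t => sphDecay lam t * greenBI (fun t => sph lam (hyp t)) g t) (𝓝[>] 0) (𝓝 0) := by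
  obtain ⟨m, hm, hmin⟩ := exists_sph_hyp_sq_ge lam
  obtain ⟨Φ, hΦ, hΦle⟩ := exists_sph_hyp_le lam
  set T1 := tailIntegral (fun t => sph lam (hyp t)) 1 with hT1
  set K := Φ * M * Real.sinh 2 with hK
  have hT1pos : 0 < T1 :=
    tailIntegral_pos (hφ_sph lam) (hpos_sph lam) (integrableOn_roIntegrand_sph hlam) one_pos
  have hlim : Tendsto (fun t => Φ * T1 * K * t + Φ * K / (2 * m) * (-(Real.log t * t))) (𝓝[>] 0) (𝓝 0) := by
    have h1 : Tendsto (fun t : ℝ => t) (𝓝[>] 0) (𝓝 0) := tendsto_id.mono_left nhdsWithin_le_nhds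
    have h2 : Tendsto (fun t : ℝ => Real.log t * t) (𝓝[>] 0) (𝓝 0) := by
      have := tendsto_log_mul_rpow_nhdsGT_zero one_pos
      simpa only [Real.rpow_one] using this
    have := (h1.const_mul (Φ * T1 * K)).add (h2.neg.const_mul (Φ * K / (2 * m)))
    simpa only [mul_zero, neg_zero, add_zero] using this
  refine squeeze_zero_norm' ?_ hlim
  filter_upwards [Ioo_mem_nhdsGT one_pos] with t ht
  have hT := tailIntegral_le_of_le_one hlam hm hmin ht.1 ht.2.le
  have hBle := abs_greenBI_le hM hM0 hΦle hΦ.le ht.1 ht.2.le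
  have hTpos : 0 < tailIntegral (fun t => sph lam (hyp t)) t :=
    tailIntegral_pos (hφ_sph lam) (hpos_sph lam) (integrableOn_roIntegrand_sph hlam) ht.1
  have hlog : 0 ≤ -Real.log t := neg_nonneg.mpr (Real.log_nonpos ht.1.le ht.2.le)
  have hχle : sphDecay lam t ≤ Φ * (T1 + (-Real.log t) / (2 * m)) := by
    show sph lam (hyp t) * tailIntegral (fun t => sph lam (hyp t)) t ≤ _
    exact mul_le_mul (hΦle t ⟨ht.1.le, ht.2.le⟩) hT hTpos.le hΦ.le
  rw [Real.norm_eq_abs, abs_mul, abs_of_pos (sphDecay_pos hlam ht.1)]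
  calc sphDecay lam t * |greenBI (fun t => sph lam (hyp t)) g t|
      ≤ (Φ * (T1 + (-Real.log t) / (2 * m))) * (K * t) :=
        mul_le_mul hχle hBle (abs_nonneg _)
          (mul_nonneg hΦ.le (add_nonneg hT1pos.le (div_nonneg hlog (by positivity))))
    _ = Φ * T1 * K * t + Φ * K / (2 * m) * (-(Real.log t * t)) := by
        field_simp

omit [BorelSpace Circle] in
include hA in
/-- **`|A^I(t)| ≤ ∫_{(0,∞)} |χ_λ g sinh 2s|`** for every `t > 0`. -/
theorem abs_greenAI_le {t : ℝ} (ht : 0 < t) :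
    |greenAI (sphDecay lam) g t| ≤ ∫ s in Ioi 0, |sphDecay lam s * g s * Real.sinh (2 * s)| := by
  unfold greenAI
  calc |∫ s in Ioi t, sphDecay lam s * g s * Real.sinh (2 * s)|
      ≤ ∫ s in Ioi t, |sphDecay lam s * g s * Real.sinh (2 * s)| := by
        have := norm_integral_le_integral_norm (μ := volume.restrict (Ioi t))
          (fun s => sphDecay lam s * g s * Real.sinh (2 * s))
        simpa only [Real.norm_eq_abs] using this
    _ ≤ ∫ s in Ioi 0, |sphDecay lam s * g s * Real.sinh (2 * s)| :=
        setIntegral_mono_set hA.abs (Eventually.of_forall fun s => abs_nonneg _)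
          (LE.le.eventuallyLE (Set.Ioi_subset_Ioi ht.le))

include hlam hM hM0 hA in
/-- **THE IMPROPER GREEN'S SOLUTION IS BOUNDED AT THE ORIGIN** for a source bounded on `(0, 1]` and integrable
against the basis. -/
theorem eventually_abs_greenSolI_le :
    ∃ B : ℝ, ∀ᶠ t in 𝓝[>] (0 : ℝ), |greenSolI (fun t => sph lam (hyp t)) (sphDecay lam) g t| ≤ B := by
  obtain ⟨Φ, hΦ, hΦle⟩ := exists_sph_hyp_le lam
  refine ⟨1 + Φ * ∫ s in Ioi 0, |sphDecay lam s * g s * Real.sinh (2 * s)|, ?_⟩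
  have hχB := tendsto_sphDecay_mul_greenBI hlam hM hM0
  filter_upwards [hχB.eventually (eventually_abs_sub_lt 0 one_pos), Ioo_mem_nhdsGT one_pos] with t h1 ht
  rw [sub_zero] at h1
  unfold greenSolI
  have hA' := abs_greenAI_le hA ht.1
  have hφ : 0 < sph lam (hyp t) := sph_hyp_pos lam t
  calc |-(sphDecay lam t * greenBI (fun t => sph lam (hyp t)) g t) - sph lam (hyp t) * greenAI (sphDecay lam) g t|
      ≤ |-(sphDecay lam t * greenBI (fun t => sph lam (hyp t)) g t)|
          + |sph lam (hyp t) * greenAI (sphDecay lam) g t| := abs_sub _ _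
    _ = |sphDecay lam t * greenBI (fun t => sph lam (hyp t)) g t|
          + sph lam (hyp t) * |greenAI (sphDecay lam) g t| := by
          rw [abs_neg, abs_mul (sph lam (hyp t)), abs_of_pos hφ]
    _ ≤ 1 + Φ * ∫ s in Ioi 0, |sphDecay lam s * g s * Real.sinh (2 * s)| := by
        have h2 : sph lam (hyp t) * |greenAI (sphDecay lam) g t|
            ≤ Φ * ∫ s in Ioi 0, |sphDecay lam s * g s * Real.sinh (2 * s)| :=
          mul_le_mul (hΦle t ⟨ht.1.le, ht.2.le⟩) hA' (abs_nonneg _) hΦ.le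
        linarith [h1.le]

end measure

end Summit.Ventures.HodgeRepro2.T5SU11RadialGreenImproperOrigin
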